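import Summits.ResolutionOfSingularities.ResolutionOfSingularities.Theorems.MarkedTransferCampaignW46ThreadChain
import HarnessLib

/-!
# [OURS · L1 W4.6 rung (i-a)] Thread chains, II: all members are two-dimensional; the valuation ring of the chain,
# `O = ⋃ R k`, and principalization of `J k` for large `k`
# (cell res-hironaka, LADDER-RESOLUTION rung L, D-0089; campaign s46, prover res-L1-s46-pv-1; host route MarkedTransfer,
# `--supports stmt-ResolutionOfSingularities-16155`)

HONEST FRAMING. Nothing here is a statement of H. Hironaka's manuscript (2017-03-23, [Hironaka2017]). Pure commutative
algebra inside a field `F` about the thread chains of `MarkedTransferCampaignW46ThreadChain.lean` (`IsThreadChain b R J`),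
over the tree's quadratic-transform theory. AI review is weaker than expert review. No `sorry`; axioms standard.

## Contents

* `ringKrullDim_eq_two` — every member has dimension exactly two (the curve/point cases are impossible,
  `false_of_ringKrullDim_le_one`).
* **The valuation ring of the chain** (`exists_valuationSubring`, Chevalley for chains, tree
  `exists_valuationSubring_subringDominates_chain`); every step is the quadratic transform ALONG it (`along`, tree
  `IsQuadraticTransform.along`); **`O = ⋃ R k`** (`mem_iff_exists_mem`, Abhyankar's union lemma, tree
  `AbhyankarQuadraticUnion_holds`); `exists_finset_subset`.
* **Principalization along the chain** (`exists_forall_isPrincipal`): `J k` is principal for all large `k` — a generator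
  `g₀` of `J 0` of extreme value divides the others in `O`, hence in some `R N` (the pattern of the tree's
  `finite_idealBaseTree_of_isRegularLocalRing`), and the cumulative transform law `P · J k = J 0 · R k`
  (`exists_span_mul_eq_extIdeal`).

## References

* O. Zariski, P. Samuel, *Commutative Algebra* II (1960), Appendix 5; Ch. VI §4 Thm. 5. [ZariskiSamuel1960]
* S. S. Abhyankar, Amer. J. Math. 78 (1956), Lemma 12. [Abhyankar1956Valuations]
* S. D. Cutkosky, Math. Ann. 362 (2015), §2.2. [Cutkosky2014]
-/

noncomputable section

set_option linter.dupNamespace false -- mandated namespace of this single-conjunct summit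

open IsLocalRing

namespace Summit.ResolutionOfSingularities.ResolutionOfSingularities.Theorems

namespace CampaignW46

open Literature.AlgebraicGeometry.Resolution

universe u

variable {F : Type u} [Field F]

namespace IsThreadChain

variable {b : ℕ} {R : ℕ → Subring F} {J : ∀ k, Ideal (R k)} (h : IsThreadChain b R J)
include h

/-! ## All members are two-dimensional; the valuation ring of the chain -/

/-- Every member of a thread chain has dimension exactly `2`. [folklore] -/
theorem ringKrullDim_eq_two (k : ℕ) : ringKrullDim (R k) = 2 := by
  haveI := h.isRegularLocalRing k
  obtain ⟨e, he⟩ := WithBot.ne_bot_iff_exists.mp (ringKrullDim_ne_bot (R := R k))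
  have het : e ≠ ⊤ := fun ht => ringKrullDim_ne_top (R := R k) (by rw [← he, ht]; rfl)
  obtain ⟨d, rfl⟩ := ENat.ne_top_iff_exists.mp het
  have h2 := h.ringKrullDim_le k
  rw [← he] at h2
  have hd2 : d ≤ 2 := by
    have hA : ((d : ℕ∞) : WithBot ℕ∞) ≤ ((2 : ℕ∞) : WithBot ℕ∞) := h2
    have hB : (d : ℕ∞) ≤ (2 : ℕ) := WithBot.coe_le_coe.mp hA
    exact ENat.coe_le_coe.mp hB
  rcases Nat.lt_or_ge d 2 with hlt | hge
  · exact (h.false_of_ringKrullDim_le_one (k₀ := k) (by rw [← he]; exact_mod_cast Nat.le_of_lt_succ hlt)).elim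
  · rw [← he]
    have : d = 2 := le_antisymm hd2 hge
    rw [this]; rfl

/-- **The valuation ring of the chain** (Chevalley): some valuation ring `O` of `F` dominates every member.
[cite: ZariskiSamuel1960, Ch. VI §4, Thm. 5] -/
theorem exists_valuationSubring : ∃ O : ValuationSubring F, ∀ k, SubringDominates (R k) O.toSubring :=
  exists_valuationSubring_subringDominates_chain R (fun k => (h.isRegularLocalRing k).toIsLocalRing)
    fun k => (h.isQuadraticTransform k).dominates

/-- Every step is the quadratic transform ALONG any valuation ring dominating the chain. [cite: Cutkosky2014, §2.2] -/
theorem along {O : ValuationSubring F} (hO : ∀ k, SubringDominates (R k) O.toSubring) (k : ℕ) :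
    IsQuadraticTransformAlong O (R k) (R (k + 1)) := by
  haveI := h.isRegularLocalRing k
  exact (h.isQuadraticTransform k).along ⟨inferInstance, IsNoetherian.noetherian _⟩ (hO (k + 1))

/-- **`O = ⋃ R k`** (Abhyankar's union lemma, tree `AbhyankarQuadraticUnion_holds`). [cite: Abhyankar1956Valuations, Lemma 12] -/
theorem mem_iff_exists_mem {O : ValuationSubring F} (hO : ∀ k, SubringDominates (R k) O.toSubring) (z : F) :
    z ∈ O ↔ ∃ k, z ∈ R k :=
  AbhyankarQuadraticUnion_holds F O R (h.isRegularLocalRing 0) (h.ringKrullDim_eq_two 0) h.isLocalRingOf (hO 0)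
    (h.along hO) z

/-- A finite set of elements of `O` lies in some member of the chain. [folklore] -/
theorem exists_finset_subset {O : ValuationSubring F} (hO : ∀ k, SubringDominates (R k) O.toSubring)
    (S : Finset F) (hS : ∀ z ∈ S, z ∈ O) : ∃ k, ∀ z ∈ S, z ∈ R k := by
  classical
  choose! ι hι using fun z (hz : z ∈ S) => (h.mem_iff_exists_mem hO z).mp (hS z hz)
  exact ⟨S.sup ι, fun z hz => h.mono (Finset.le_sup hz) (hι z hz)⟩

/-! ## Principalization along the chain -/

omit h in
/-- `extIdeal J R = J`. [folklore] -/
theorem _root_.Summit.ResolutionOfSingularities.ResolutionOfSingularities.Theorems.CampaignW46.extIdeal_self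
    {S : Subring F} (I : Ideal S) : extIdeal I S = I := by
  rw [extIdeal_eq_map I le_rfl]
  have : Subring.inclusion (le_refl S) = RingHom.id S := RingHom.ext fun _ => Subtype.ext rfl
  rw [this, Ideal.map_id]

/-- **Cumulative transform law**: `P · J k = J 0 · R k` for some non-zero `P ∈ R k` (the product of the `x_i^b`).
[folklore] -/
theorem exists_span_mul_eq_extIdeal (k : ℕ) : ∃ P : R k, P ≠ 0 ∧ Ideal.span {P} * J k = extIdeal (J 0) (R k) := by
  induction k with
  | zero => exact ⟨1, one_ne_zero, by rw [Ideal.span_singleton_one, Ideal.top_mul, extIdeal_self]⟩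
  | succ k ih =>
    obtain ⟨P, hP0, hP⟩ := ih
    obtain ⟨x, hxR, hx0, -, -, hx1, hmx⟩ := h.exists_generator k
    have hprod := h.span_pow_mul_eq k hx1 hmx
    let ι := Subring.inclusion (h.le_succ k)
    refine ⟨ι P * (⟨x, hx1⟩ : R (k + 1)) ^ b, ?_, ?_⟩
    · refine mul_ne_zero ?_ (pow_ne_zero _ fun e => hx0 (congrArg Subtype.val e))
      exact fun e => hP0 (Subring.inclusion_injective _ (by rw [e, map_zero]))
    · rw [← Ideal.span_singleton_mul_span_singleton, mul_assoc, hprod, extIdeal_eq_map _ (h.le_succ k),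
        ← map_extIdeal (J 0) (h.mono (Nat.zero_le k)) (h.le_succ k), ← hP, Ideal.map_mul, Ideal.map_span,
        Set.image_singleton]

/-- **Principalization**: `J k` is principal for all large `k`. A generator `g₀` of `J 0` of extreme value divides the
others in `O = ⋃ R i`, hence in some `R N`, so `J 0 · R k = g₀ R k` for `k ≥ N`; and `P · J k = J 0 · R k` with
`P ≠ 0` in the domain `R k`. [cite: ZariskiSamuel1960, Appendix 5] -/
theorem exists_forall_isPrincipal : ∃ N, ∀ k, N ≤ k → (J k).IsPrincipal := by
  classical
  obtain ⟨O, hO⟩ := h.exists_valuationSubring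
  haveI := h.isRegularLocalRing 0
  obtain ⟨s, hs⟩ := (IsNoetherian.noetherian (J 0) : (J 0).FG)
  have hsne : (s.filter fun g : R 0 => (g : F) ≠ 0).Nonempty := by
    by_contra hempty
    rw [Finset.not_nonempty_iff_eq_empty, Finset.filter_eq_empty_iff] at hempty
    apply h.ne_bot 0
    rw [← hs, Ideal.span_eq_bot]
    intro g hg
    have := hempty hg
    push Not at this
    exact Subtype.ext this
  obtain ⟨g₀, hg₀s, hmax⟩ := Finset.exists_max_image (s.filter fun g : R 0 => (g : F) ≠ 0)
    (fun g => O.valuation (g : F)) hsne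
  obtain ⟨hg₀s', hg₀0⟩ := Finset.mem_filter.mp hg₀s
  have hg₀J : g₀ ∈ J 0 := hs ▸ Ideal.subset_span hg₀s'
  have hdivO : ∀ g ∈ s, (g : F) / (g₀ : F) ∈ O := by
    intro g hg
    by_cases hg0 : (g : F) = 0
    · rw [hg0, zero_div]; exact O.zero_mem
    · rw [← O.valuation_le_one_iff, map_div₀, div_le_one₀ (pos_iff_ne_zero.mpr ((map_ne_zero _).mpr hg₀0))]
      exact hmax g (Finset.mem_filter.mpr ⟨hg, hg0⟩)
  obtain ⟨N, hN⟩ := h.exists_finset_subset hO (s.image fun g : R 0 => (g : F) / (g₀ : F)) (by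
    intro z hz
    obtain ⟨g, hg, rfl⟩ := Finset.mem_image.mp hz
    exact hdivO g hg)
  refine ⟨N, fun k hk => ?_⟩
  haveI := h.isRegularLocalRing k
  have hle : R 0 ≤ R k := h.mono (Nat.zero_le k)
  -- `J 0 · R k = g₀ R k`
  have hext : extIdeal (J 0) (R k) = Ideal.span {Subring.inclusion hle g₀} := by
    apply le_antisymm
    · rw [← hs, extIdeal_eq_map _ hle, Ideal.map_span, Ideal.span_le]
      rintro _ ⟨g, hg, rfl⟩
      rw [SetLike.mem_coe, Ideal.mem_span_singleton']
      have hq : (g : F) / (g₀ : F) ∈ R k :=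
        h.mono hk (hN _ (Finset.mem_image.mpr ⟨g, Finset.mem_coe.mp hg, rfl⟩))
      refine ⟨⟨(g : F) / (g₀ : F), hq⟩, Subtype.ext ?_⟩
      change (g : F) / (g₀ : F) * (g₀ : F) = (g : F)
      rw [div_mul_cancel₀ _ hg₀0]
    · rw [Ideal.span_singleton_le_iff_mem, extIdeal_eq_map _ hle]
      exact Ideal.mem_map_of_mem _ hg₀J
  obtain ⟨P, hP0, hP⟩ := h.exists_span_mul_eq_extIdeal k
  rw [hext] at hP
  exact (isPrincipal_span_singleton_mul_iff hP0 (J k)).mp ⟨⟨_, hP.trans (Ideal.submodule_span_eq).symm⟩⟩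

end IsThreadChain

end CampaignW46

end Summit.ResolutionOfSingularities.ResolutionOfSingularities.Theorems

end
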